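import Summits.NavierStokesRegularity.NavierStokesRegularity.Theorems.TypeICertificateLadderTargetTypeIZoom
import Summits.NavierStokesRegularity.NavierStokesRegularity.Theorems.HubbleDynamoDynamoKillsTypeIZoomTools
import HarnessLib

/-!
# Route HubbleDynamo — support item `DynamoKillsTypeI` (stmt-NavierStokesRegularity-1936):
  helper 2, the KNSS zoom in the POINTWISE Type-I class at unit viscosity

Helper file (theorems only) towards the zoom glue `DynamoKillsTypeI` of route HubbleDynamo.
For a classical solution `(u, p)` of Navier–Stokes (`ν = 1`) on `ℝ³ × [0, T)`, Leray–Hopf from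
its rapidly decaying datum, with the eventual rate `√(T − t)‖u(t, x)‖ ≤ C`, which is a space–time
Type-I centre at EVERY point (`‖u(t, x)‖ ≤ C'/(‖x − x₀‖ + √(T − t))` on a backward neighbourhood
of each `(T, x₀)`, the conclusion of the crux `FarFieldSlaving`) and which does NOT extend
classically past `T`, the zoom `hubbleDynamo_zoom_unit` produces a BOUNDED ancient mild solution
`W` (duality form, `IsBoundedAncientMildSolution 1 W`) with continuous (hence measurable) slices,
the pointwise Type-I decay `HasTypeIDecay C' W`, and a slice which is not a.e. zero — exactly an
object killed by the crux `NoSelfExcitedDynamo`.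

The proof (Koch–Nadirashvili–Seregin–Šverák 2009, §6, proof of Thm. 6.2 with Lemma 6.1,
arXiv:0709.3599 pp. 11–13) follows the tree's `typeIZoom_unit`
(`TypeICertificateLadderTargetTypeIZoom.lean`) with three additions: (i) Leray points `(t_k, x_k)`
(`‖u(t_k, x_k)‖ ≥ c/√(T − t_k)`, `typeIZoom_leray_point`) stay in the ball `‖x‖ ≤ R` once
`c/√(T − t_k)` exceeds the far-field bound (`hubbleDynamo_farField_pointwise`), so a subsequence
has `x_k → x*`; (ii) the zoom `w_k(τ, y) = λ_k u(t_k + λ_k²(σ₀ + τ), x* + λ_k y)`,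
`λ_k = ‖u(t_k, x_k)‖⁻¹`, is CENTRED AT `x*` with Leray's vertex shift `σ₀ = c²/2`, which makes the
zoomed fields uniformly bounded by `C/√σ₀` on the past (`B_k = S_k − σ₀ ≥ σ₀`) and puts the
normalisation `‖w_k(−σ₀, y_k)‖ = 1` at `y_k = ‖u(t_k, x_k)‖ (x_k − x*)`, `‖y_k‖ ≤ C'` by the
slaving bound at `x*`; (iii) the slaving bound at `x*` is scale invariant about `(T, x*)` and
passes to the zoom as `‖w_k(τ, y)‖ ≤ C'/(‖y‖ + √(−τ))` eventually in `k`. The limit step is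
`hubbleDynamo_zoom_limit` (helper 1).

Lands `--supports stmt-NavierStokesRegularity-1936`.
-/

noncomputable section

namespace Summit.NavierStokesRegularity.NavierStokesRegularity.Theorems

open MeasureTheory Set Filter Topology Function Metric
open scoped RealInnerProductSpace NNReal ENNReal
open Literature.Analysis Literature.Analysis.FluidPDE

/-! ### The zoom at unit viscosity, in the pointwise Type-I class -/

/-- **The Type-I zoom in the pointwise class** (KNSS 2009, §6, proof of Theorem 6.2 with
Lemma 6.1, run at Leray points with a convergent centre `x_k → x*`, the zoom centred at `x*`
and the vertex shifted by `σ₀ = c²/2`; see the module docstring). For `C > 0`, `T > 0`,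
`(u, p)` classical (`ν = 1`) on `ℝ³ × [0, T)`, Leray–Hopf from its rapidly decaying datum, with
`√(T − t)‖u(t, x)‖ ≤ C` eventually as `t ↑ T`, a space–time Type-I centre at every point, and
not extending classically past `T`: there is a bounded ancient mild solution `W` (`ν = 1`) with
a.e.-strongly measurable slices, `HasTypeIDecay C' W` for some `C'`, and a slice `W t`, `t < 0`,
which is not a.e. zero.
[cite: KochNadirashviliSereginSverak2009, §6 proof of Thm 6.2 with Lemma 6.1 (arXiv:0709.3599 pp. 11–13)] -/
theorem hubbleDynamo_zoom_unit {C T : ℝ} (hC : 0 < C) (hT : 0 < T)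
    {u : ℝ → EuclideanSpace ℝ (Fin 3) → EuclideanSpace ℝ (Fin 3)}
    {p : ℝ → EuclideanSpace ℝ (Fin 3) → ℝ}
    (hcl : IsClassicalNSSolutionOn (Ico 0 T) 1 0 u p) (hLH : IsLerayHopfOn T 1 0 (u 0) u)
    (hdec : HasRapidSpatialDecay (u 0))
    (hrate : ∀ᶠ t in 𝓝[<] T, ∀ x, Real.sqrt (T - t) * ‖u t x‖ ≤ C)
    (hslave : ∀ x₀ : EuclideanSpace ℝ (Fin 3), ∃ δ : ℝ, 0 < δ ∧ ∃ C' : ℝ,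
      ∀ t ∈ Ioo (T - δ ^ 2) T, ∀ x ∈ ball x₀ δ, ‖u t x‖ ≤ C' / (‖x - x₀‖ + Real.sqrt (T - t)))
    (hext : ¬ HasSmoothExtensionPast 1 0 u T) :
    ∃ W : ℝ → EuclideanSpace ℝ (Fin 3) → EuclideanSpace ℝ (Fin 3),
      IsBoundedAncientMildSolution 1 W ∧ (∀ t < 0, AEStronglyMeasurable (W t) volume) ∧
      (∃ C' : ℝ, HasTypeIDecay C' W) ∧ ∃ t < 0, ¬ (W t =ᵐ[volume] 0) := by
  -- ### Step 1: Leray's constant and the far-field bound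
  obtain ⟨c, hc, hler⟩ := typeIZoom_leray_point
  obtain ⟨Tf, hTfT, R, K, hfar⟩ := hubbleDynamo_farField_pointwise hT hcl hLH hdec
  -- ### Step 2: the rate window `(T', T)`, `0 < T'`, inside the far-field window and so short
  -- that Leray's lower rate beats the far-field bound
  obtain ⟨T₀, hT₀T, hT₀⟩ := mem_nhdsLT_iff_exists_Ioo_subset.1 hrate
  set η : ℝ := (c / (|K| + 1)) ^ 2 with hηdef
  have hK1 : 0 < |K| + 1 := by positivity
  have hη : 0 < η := by positivity
  set T' : ℝ := max (max T₀ (T / 2)) (max Tf (T - η)) with hT'def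
  have hT'T : T' < T := max_lt (max_lt hT₀T (by linarith)) (max_lt hTfT (by linarith))
  have hT'pos : 0 < T' :=
    lt_of_lt_of_le (by linarith) ((le_max_right _ _).trans (le_max_left _ _))
  have hT'₀ : T₀ ≤ T' := (le_max_left _ _).trans (le_max_left _ _)
  have hT'f : Tf ≤ T' := (le_max_left _ _).trans (le_max_right _ _)
  have hT'η : T - η ≤ T' := (le_max_right _ _).trans (le_max_right _ _)
  have hrate' : ∀ t ∈ Ioo T' T, ∀ x, Real.sqrt (T - t) * ‖u t x‖ ≤ C := fun t ht x =>
    hT₀ ⟨lt_of_le_of_lt hT'₀ ht.1, ht.2⟩ x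
  -- the Oseen equation between all pairs of positive times of `u`
  have hoseen : ∀ s t : ℝ, 0 < s → s < t → t < T → ∀ X,
      u t X = UnboundedOperators.heatExtension (u s) (t - s) X - oseenDuhamel 1 s u u t X := by
    intro s t hs hst htT X
    have h := typeIZoom_oseen_pairs 1 T u p one_pos hT hcl hLH hdec s t hs hst htT X
    rwa [one_mul] at h
  -- ### Step 3: Leray points along `t_k ↑ T`; they stay in the ball `‖x‖ ≤ R`
  set δ : ℝ := T - T' with hδ
  have hδpos : 0 < δ := sub_pos.2 hT'T
  set tk : ℕ → ℝ := fun k => T - δ / ((k : ℝ) + 2) with htk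
  have hk2 : ∀ k : ℕ, (0 : ℝ) < (k : ℝ) + 2 := fun k => by positivity
  have hTtk : ∀ k, T - tk k = δ / ((k : ℝ) + 2) := fun k => by simp [htk]
  have htk_lt : ∀ k, tk k < T := fun k => by
    have : 0 < δ / ((k : ℝ) + 2) := div_pos hδpos (hk2 k)
    simp only [htk]; linarith
  have htk_gt : ∀ k, T' < tk k := fun k => by
    have : δ / ((k : ℝ) + 2) < δ := div_lt_self hδpos (by linarith [Nat.cast_nonneg (α := ℝ) k])
    simp only [htk]; linarith
  have htk_ge : ∀ k, T' + δ / 2 ≤ tk k := fun k => by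
    have : δ / ((k : ℝ) + 2) ≤ δ / 2 :=
      div_le_div_of_nonneg_left hδpos.le two_pos (by linarith [Nat.cast_nonneg (α := ℝ) k])
    simp only [htk]; linarith
  have htk0 : ∀ k, 0 ≤ tk k := fun k => (hT'pos.trans (htk_gt k)).le
  have hpt : ∀ k, ∃ x, c / Real.sqrt (T - tk k) ≤ ‖u (tk k) x‖ := by
    intro k
    obtain ⟨x, hx⟩ := hler one_pos hT hcl hLH hdec hext (tk k) ⟨htk0 k, htk_lt k⟩
    refine ⟨x, ?_⟩
    simpa [Real.sqrt_one] using hx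
  choose xk hxk using hpt
  have hxkR : ∀ k, xk k ∈ closedBall (0 : EuclideanSpace ℝ (Fin 3)) R := by
    intro k
    rw [mem_closedBall_zero_iff]
    by_contra hno
    push Not at hno
    have hfk := hfar (tk k) ⟨lt_of_le_of_lt hT'f (htk_gt k), htk_lt k⟩ (xk k) hno
    have hpos : 0 < T - tk k := sub_pos.2 (htk_lt k)
    have hlt : T - tk k < (c / (|K| + 1)) ^ 2 := by
      have h1 := htk_gt k
      have h2 : T - η < tk k := lt_of_le_of_lt hT'η h1
      rw [hηdef] at h2
      linarith
    have hsq : Real.sqrt (T - tk k) < c / (|K| + 1) := by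
      calc Real.sqrt (T - tk k) < Real.sqrt ((c / (|K| + 1)) ^ 2) :=
            Real.sqrt_lt_sqrt hpos.le hlt
        _ = c / (|K| + 1) := Real.sqrt_sq (by positivity)
    have hKc : |K| + 1 < c / Real.sqrt (T - tk k) := by
      rw [lt_div_iff₀ (Real.sqrt_pos.2 hpos)]
      calc (|K| + 1) * Real.sqrt (T - tk k) < (|K| + 1) * (c / (|K| + 1)) :=
            mul_lt_mul_of_pos_left hsq hK1
        _ = c := by field_simp
    linarith [le_abs_self K, hxk k]
  -- ### Step 4: a convergent subsequence of Leray points, `x_{ψ k} → x*`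
  obtain ⟨xs, -, ψ, hψ, hxs⟩ := tendsto_subseq_of_bounded isBounded_closedBall hxkR
  set tk' : ℕ → ℝ := fun k => tk (ψ k) with htk'
  set xk' : ℕ → EuclideanSpace ℝ (Fin 3) := fun k => xk (ψ k) with hxk'
  have hψk : ∀ k : ℕ, (k : ℝ) ≤ (ψ k : ℝ) := fun k => Nat.cast_le.2 (hψ.id_le k)
  have htk'_lt : ∀ k, tk' k < T := fun k => htk_lt _
  have htk'_gt : ∀ k, T' < tk' k := fun k => htk_gt _
  have htk'_ge : ∀ k, T' + δ / 2 ≤ tk' k := fun k => htk_ge _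
  have htk'0 : ∀ k, 0 ≤ tk' k := fun k => htk0 _
  have hxk'T : ∀ k, c / Real.sqrt (T - tk' k) ≤ ‖u (tk' k) (xk' k)‖ := fun k => hxk _
  have hTtk'_le : ∀ k, T - tk' k ≤ δ / ((k : ℝ) + 2) := fun k => by
    show T - tk (ψ k) ≤ _
    rw [hTtk]
    exact div_le_div_of_nonneg_left hδpos.le (hk2 k) (by linarith [hψk k])
  have hxs' : Tendsto xk' atTop (𝓝 xs) := hxs
  have hnat : Tendsto (fun k : ℕ => (k : ℝ) + 2) atTop atTop :=
    tendsto_atTop_add_const_right _ _ tendsto_natCast_atTop_atTop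
  have htk'T : Tendsto tk' atTop (𝓝 T) := by
    have hdiv0 : Tendsto (fun k : ℕ => δ / ((k : ℝ) + 2)) atTop (𝓝 0) :=
      tendsto_const_nhds.div_atTop hnat
    have hlow : Tendsto (fun k : ℕ => T - δ / ((k : ℝ) + 2)) atTop (𝓝 T) := by
      simpa using tendsto_const_nhds.sub hdiv0
    refine tendsto_of_tendsto_of_tendsto_of_le_of_le hlow tendsto_const_nhds (fun k => ?_)
      (fun k => (htk'_lt k).le)
    have := hTtk'_le k
    linarith
  -- ### Step 5: the blow-up scales
  set M : ℕ → ℝ := fun k => ‖u (tk' k) (xk' k)‖ with hMdef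
  have hsqpos : ∀ k, 0 < Real.sqrt (T - tk' k) := fun k =>
    Real.sqrt_pos.2 (sub_pos.2 (htk'_lt k))
  have hMlow : ∀ k, c / Real.sqrt (T - tk' k) ≤ M k := hxk'T
  have hMpos : ∀ k, 0 < M k := fun k => lt_of_lt_of_le (div_pos hc (hsqpos k)) (hMlow k)
  have hcle : ∀ k, c ≤ Real.sqrt (T - tk' k) * M k := fun k => by
    have h := (div_le_iff₀ (hsqpos k)).1 (hMlow k)
    rwa [mul_comm] at h
  -- `S_k = (T − t_k) M_k² ≥ c²`
  have hS : ∀ k, c ^ 2 ≤ (T - tk' k) * M k ^ 2 := fun k => by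
    have h := pow_le_pow_left₀ hc.le (hcle k) 2
    rwa [mul_pow, Real.sq_sqrt (sub_pos.2 (htk'_lt k)).le] at h
  -- `M_k² ≥ c² (k + 2) / δ`
  have hM2 : ∀ k : ℕ, c ^ 2 * ((k : ℝ) + 2) / δ ≤ M k ^ 2 := fun k => by
    have h' : c ^ 2 ≤ δ / ((k : ℝ) + 2) * M k ^ 2 :=
      (hS k).trans (mul_le_mul_of_nonneg_right (hTtk'_le k) (sq_nonneg _))
    rw [div_le_iff₀ hδpos]
    have e : δ / ((k : ℝ) + 2) * M k ^ 2 * ((k : ℝ) + 2) = M k ^ 2 * δ := by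
      field_simp
    have h2 := mul_le_mul_of_nonneg_right h' (hk2 k).le
    rw [e] at h2
    linarith
  -- ### Step 6: the zoom centred at `x*` with the vertex shifted by `σ₀ = c²/2`
  set σ₀ : ℝ := c ^ 2 / 2 with hσ₀def
  have hσ₀ : 0 < σ₀ := by positivity
  set lam : ℕ → ℝ := fun k => (M k)⁻¹ with hlamdef
  have hlam : ∀ k, 0 < lam k := fun k => inv_pos.2 (hMpos k)
  have hlamM : ∀ k, lam k * M k = 1 := fun k => inv_mul_cancel₀ (hMpos k).ne'
  have hlam2 : ∀ k, lam k ^ 2 * M k ^ 2 = 1 := fun k => by rw [← mul_pow, hlamM, one_pow]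
  set t0 : ℕ → ℝ := fun k => tk' k + σ₀ * lam k ^ 2 with ht0def
  set w : ℕ → ℝ → EuclideanSpace ℝ (Fin 3) → EuclideanSpace ℝ (Fin 3) :=
    fun k => lam k • stPull (lam k ^ 2) (lam k) (t0 k) xs u with hwdef
  set q : ℕ → ℝ → EuclideanSpace ℝ (Fin 3) → ℝ :=
    fun k => lam k ^ 2 • stPull (lam k ^ 2) (lam k) (t0 k) xs p with hqdef
  set A : ℕ → ℝ := fun k => (T' - t0 k) * M k ^ 2 with hAdef
  set B : ℕ → ℝ := fun k => (T - t0 k) * M k ^ 2 with hBdef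
  -- the physical time of `τ` is `t₀ + λ² τ`; `A_k ↦ T'`, `B_k ↦ T`
  have hphysA : ∀ k, t0 k + lam k ^ 2 * A k = T' := fun k => by
    have e : lam k ^ 2 * ((T' - t0 k) * M k ^ 2) = (T' - t0 k) * (lam k ^ 2 * M k ^ 2) := by ring
    simp only [hAdef]
    rw [e, hlam2, mul_one]
    ring
  have hphysB : ∀ k, t0 k + lam k ^ 2 * B k = T := fun k => by
    have e : lam k ^ 2 * ((T - t0 k) * M k ^ 2) = (T - t0 k) * (lam k ^ 2 * M k ^ 2) := by ring
    simp only [hBdef]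
    rw [e, hlam2, mul_one]
    ring
  have hphys_lt : ∀ k, ∀ {σ τ : ℝ}, σ < τ → t0 k + lam k ^ 2 * σ < t0 k + lam k ^ 2 * τ :=
    fun k σ τ h => by have := pow_pos (hlam k) 2; nlinarith
  have hphys : ∀ k, ∀ τ ∈ Ioo (A k) (B k), t0 k + lam k ^ 2 * τ ∈ Ioo T' T := fun k τ hτ =>
    ⟨by rw [← hphysA k]; exact hphys_lt k hτ.1, by rw [← hphysB k]; exact hphys_lt k hτ.2⟩
  -- `B_k = S_k − σ₀ ≥ σ₀ > 0`, `T − t₀ > 0`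
  have hBeq : ∀ k, B k = (T - tk' k) * M k ^ 2 - σ₀ := fun k => by
    simp only [hBdef, ht0def]
    have := hlam2 k
    linear_combination (-σ₀) * this
  have hBσ : ∀ k, σ₀ ≤ B k := fun k => by
    rw [hBeq k]
    have := hS k
    simp only [hσ₀def]
    nlinarith
  have hBpos : ∀ k, 0 < B k := fun k => lt_of_lt_of_le hσ₀ (hBσ k)
  have hTt0 : ∀ k, 0 < T - t0 k := fun k => by
    have h1 : 0 < (T - t0 k) * M k ^ 2 := hBpos k
    exact lt_of_mul_lt_mul_right (by rwa [zero_mul]) (sq_nonneg (M k))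
  have hTphys : ∀ k τ, T - (t0 k + lam k ^ 2 * τ) = lam k ^ 2 * (B k - τ) := fun k τ => by
    have := hphysB k
    linear_combination (-1 : ℝ) * this
  -- `A_k → −∞`
  have hA_le : ∀ k : ℕ, A k ≤ -(c ^ 2 / 2) * ((k : ℝ) + 2) - σ₀ := fun k => by
    have hAeq : A k = (T' - tk' k) * M k ^ 2 - σ₀ := by
      simp only [hAdef, ht0def]
      have := hlam2 k
      linear_combination (-σ₀) * this
    rw [hAeq]
    have h1 : T' - tk' k ≤ -(δ / 2) := by linarith [htk'_ge k]
    have hM2k := hM2 k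
    have hM20 : 0 ≤ M k ^ 2 := sq_nonneg _
    have h2 : (T' - tk' k) * M k ^ 2 ≤ -(δ / 2) * M k ^ 2 := mul_le_mul_of_nonneg_right h1 hM20
    have h3 : -(δ / 2) * M k ^ 2 ≤ -(δ / 2) * (c ^ 2 * ((k : ℝ) + 2) / δ) :=
      mul_le_mul_of_nonpos_left hM2k (by linarith)
    have h4 : -(δ / 2) * (c ^ 2 * ((k : ℝ) + 2) / δ) = -(c ^ 2 / 2) * ((k : ℝ) + 2) := by
      field_simp
    linarith
  have hAlim : Tendsto A atTop atBot := by
    have hneg : -(c ^ 2 / 2) < 0 := by linarith [pow_pos hc 2]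
    have h2 : Tendsto (fun k : ℕ => -(c ^ 2 / 2) * ((k : ℝ) + 2)) atTop atBot :=
      hnat.const_mul_atTop_of_neg hneg
    exact tendsto_atBot_mono hA_le (tendsto_atBot_add_const_right _ _ h2)
  -- the zoomed fields are classical on `(A_k, B_k)`
  have hwcl : ∀ k, IsClassicalNSSolutionOn (Ioo (A k) (B k)) 1 0 (w k) (q k) := by
    intro k
    have h := hcl.nsRescale_translate_zero (hlam k) (t0 k) xs
    refine h.mono (fun τ hτ => ?_) isOpen_Ioo.uniqueDiffOn
    have hp := hphys k τ hτ
    exact ⟨(hT'pos.trans hp.1).le, hp.2⟩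
  -- the Oseen equation between all times of `(A_k, B_k)`
  have hwmild : ∀ k, ∀ s t : ℝ, A k < s → s < t → t < B k → ∀ y,
      w k t y = UnboundedOperators.heatExtension (w k s) (t - s) y -
        oseenDuhamel 1 s (w k) (w k) t y := by
    intro k s t hAs hst htB y
    refine oseen_smul_stPull (hlam k) (t0 k) xs hst (fun X => ?_) y
    have hsB : s < B k := hst.trans htB
    have hs' : T' < t0 k + lam k ^ 2 * s := (hphys k s ⟨hAs, hsB⟩).1
    have ht' : t0 k + lam k ^ 2 * t < T := (hphys k t ⟨hAs.trans hst, htB⟩).2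
    exact hoseen _ _ (hT'pos.trans hs') (hphys_lt k hst) ht' X
  -- the rate bound transported to the zoom: `√a · ‖w_k τ y‖ ≤ C` whenever `0 ≤ a ≤ B_k − τ`
  have hgen : ∀ k, ∀ τ ∈ Ioo (A k) 0, ∀ y, ∀ a : ℝ, 0 ≤ a → a ≤ B k - τ →
      Real.sqrt a * ‖w k τ y‖ ≤ C := by
    intro k τ hτ y a ha0 haB
    have e : w k τ y = lam k • u (t0 k + lam k ^ 2 * τ) (xs + lam k • y) := rfl
    have ht : t0 k + lam k ^ 2 * τ ∈ Ioo T' T := hphys k τ ⟨hτ.1, hτ.2.trans (hBpos k)⟩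
    have hr := hrate' _ ht (xs + lam k • y)
    rw [e, norm_smul, Real.norm_eq_abs, abs_of_pos (hlam k)]
    have hkey : Real.sqrt a * lam k ≤ Real.sqrt (T - (t0 k + lam k ^ 2 * τ)) := by
      have e1 : Real.sqrt a * lam k = Real.sqrt (a * lam k ^ 2) := by
        rw [Real.sqrt_mul ha0, Real.sqrt_sq (hlam k).le]
      rw [e1]
      refine Real.sqrt_le_sqrt ?_
      rw [hTphys]
      nlinarith [pow_pos (hlam k) 2]
    calc Real.sqrt a * (lam k * ‖u (t0 k + lam k ^ 2 * τ) (xs + lam k • y)‖)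
        = (Real.sqrt a * lam k) * ‖u (t0 k + lam k ^ 2 * τ) (xs + lam k • y)‖ := by ring
      _ ≤ Real.sqrt (T - (t0 k + lam k ^ 2 * τ)) * ‖u (t0 k + lam k ^ 2 * τ) (xs + lam k • y)‖ :=
          mul_le_mul_of_nonneg_right hkey (norm_nonneg _)
      _ ≤ C := hr
  -- the rate bound on `(A_k, 0)`
  have hwI : ∀ k, ∀ τ ∈ Ioo (A k) 0, ∀ y, Real.sqrt (-τ) * ‖w k τ y‖ ≤ C := fun k τ hτ y =>
    hgen k τ hτ y (-τ) (neg_nonneg.2 hτ.2.le) (by linarith [hBpos k])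
  -- NEW: the uniform bound `‖w_k‖ ≤ C/√σ₀` on `(A_k, 0)` (the vertex shift: `B_k − τ ≥ σ₀`)
  have hσsq : 0 < Real.sqrt σ₀ := Real.sqrt_pos.2 hσ₀
  have hwB : ∀ k, ∀ τ ∈ Ioo (A k) 0, ∀ y, ‖w k τ y‖ ≤ C / Real.sqrt σ₀ := fun k τ hτ y => by
    rw [le_div_iff₀ hσsq, mul_comm]
    exact hgen k τ hτ y σ₀ hσ₀.le (by linarith [hBσ k, hτ.2])
  -- NEW: the normalisation `‖w_k(−σ₀, y_k)‖ = 1` at `y_k = M_k (x_k − x*)`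
  set ys : ℕ → EuclideanSpace ℝ (Fin 3) := fun k => M k • (xk' k - xs) with hysdef
  have hnorm1 : ∀ k, ‖w k (-σ₀) (ys k)‖ = 1 := fun k => by
    have e : w k (-σ₀) (ys k) =
        lam k • u (t0 k + lam k ^ 2 * (-σ₀)) (xs + lam k • (M k • (xk' k - xs))) := rfl
    have et : t0 k + lam k ^ 2 * (-σ₀) = tk' k := by simp only [ht0def]; ring
    have ex : xs + lam k • (M k • (xk' k - xs)) = xk' k := by
      rw [smul_smul, hlamM k, one_smul, add_sub_cancel]
    rw [e, et, ex, norm_smul, Real.norm_eq_abs, abs_of_pos (hlam k)]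
    exact hlamM k
  -- ### Step 7: the slaving bound at `x*`, transported to the zoom
  obtain ⟨δs, hδs, C', hC'⟩ := hslave xs
  -- `λ_k → 0` and the physical times tend to `T`
  have hlam0 : Tendsto lam atTop (𝓝 0) := by
    have hup : ∀ k, lam k ≤ Real.sqrt (T - tk' k) / c := fun k => by
      rw [le_div_iff₀ hc]
      calc lam k * c ≤ lam k * (Real.sqrt (T - tk' k) * M k) :=
            mul_le_mul_of_nonneg_left (hcle k) (hlam k).le
        _ = Real.sqrt (T - tk' k) * (lam k * M k) := by ring
        _ = Real.sqrt (T - tk' k) := by rw [hlamM, mul_one]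
    have h1 : Tendsto (fun k => T - tk' k) atTop (𝓝 0) := by
      have := (tendsto_const_nhds (x := T) (f := (atTop : Filter ℕ))).sub htk'T
      simpa using this
    have h2 : Tendsto (fun k => Real.sqrt (T - tk' k)) atTop (𝓝 0) := by
      have := h1.sqrt
      rwa [Real.sqrt_zero] at this
    have h3 : Tendsto (fun k => Real.sqrt (T - tk' k) / c) atTop (𝓝 0) := by
      simpa using h2.div_const c
    exact tendsto_of_tendsto_of_tendsto_of_le_of_le tendsto_const_nhds h3 (fun k => (hlam k).le) hup
  have hphysT : ∀ τ : ℝ, Tendsto (fun k => t0 k + lam k ^ 2 * τ) atTop (𝓝 T) := fun τ => by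
    have e : (fun k => t0 k + lam k ^ 2 * τ) = fun k => tk' k + lam k ^ 2 * (σ₀ + τ) := by
      funext k; simp only [ht0def]; ring
    rw [e]
    simpa using htk'T.add ((hlam0.pow 2).mul_const (σ₀ + τ))
  -- `‖y_k‖ ≤ C'` eventually
  have hys : ∀ᶠ k in atTop, ‖ys k‖ ≤ C' := by
    have h1 : ∀ᶠ k in atTop, T - δs ^ 2 < tk' k :=
      (tendsto_order.1 htk'T).1 _ (by nlinarith [pow_pos hδs 2])
    have h2 : ∀ᶠ k in atTop, xk' k ∈ ball xs δs := hxs' (isOpen_ball.mem_nhds (mem_ball_self hδs))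
    filter_upwards [h1, h2] with k hk1 hk2
    have hb := hC' (tk' k) ⟨hk1, htk'_lt k⟩ (xk' k) hk2
    change M k ≤ C' / (‖xk' k - xs‖ + Real.sqrt (T - tk' k)) at hb
    have hden : 0 < ‖xk' k - xs‖ + Real.sqrt (T - tk' k) :=
      add_pos_of_nonneg_of_pos (norm_nonneg _) (hsqpos k)
    rw [le_div_iff₀ hden] at hb
    have hys_eq : ‖ys k‖ = M k * ‖xk' k - xs‖ := by
      show ‖M k • (xk' k - xs)‖ = _
      rw [norm_smul, Real.norm_eq_abs, abs_of_pos (hMpos k)]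
    rw [hys_eq]
    nlinarith [mul_nonneg (hMpos k).le (hsqpos k).le]
  have hC'0 : 0 ≤ C' := by
    obtain ⟨k, hk⟩ := hys.exists
    exact (norm_nonneg _).trans hk
  -- the decay bound of the zoomed fields, eventually in `k`
  have hwD : ∀ τ < 0, ∀ y, ∀ᶠ k in atTop, ‖w k τ y‖ ≤ C' / (‖y‖ + Real.sqrt (-τ)) := by
    intro τ hτ y
    have h1 : ∀ᶠ k in atTop, T - δs ^ 2 < t0 k + lam k ^ 2 * τ :=
      (tendsto_order.1 (hphysT τ)).1 _ (by nlinarith [pow_pos hδs 2])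
    have h2 : ∀ᶠ k in atTop, lam k * ‖y‖ < δs := by
      have : Tendsto (fun k => lam k * ‖y‖) atTop (𝓝 0) := by simpa using hlam0.mul_const ‖y‖
      exact (tendsto_order.1 this).2 _ hδs
    have h3 : ∀ᶠ k in atTop, A k < τ := hAlim.eventually (eventually_lt_atBot τ)
    filter_upwards [h1, h2, h3] with k hk1 hk2 hk3
    have e : w k τ y = lam k • u (t0 k + lam k ^ 2 * τ) (xs + lam k • y) := rfl
    have htT : t0 k + lam k ^ 2 * τ < T := (hphys k τ ⟨hk3, hτ.trans (hBpos k)⟩).2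
    have hxball : xs + lam k • y ∈ ball xs δs := by
      rw [mem_ball, dist_eq_norm, add_sub_cancel_left, norm_smul, Real.norm_eq_abs,
        abs_of_pos (hlam k)]
      exact hk2
    have hb := hC' _ ⟨hk1, htT⟩ _ hxball
    have eX : ‖xs + lam k • y - xs‖ = lam k * ‖y‖ := by
      rw [add_sub_cancel_left, norm_smul, Real.norm_eq_abs, abs_of_pos (hlam k)]
    have hBτ : 0 < B k - τ := by linarith [hBpos k]
    have esq : Real.sqrt (T - (t0 k + lam k ^ 2 * τ)) = lam k * Real.sqrt (B k - τ) := by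
      rw [hTphys, Real.sqrt_mul (sq_nonneg _), Real.sqrt_sq (hlam k).le]
    rw [eX, esq, ← mul_add] at hb
    have hden2 : 0 < ‖y‖ + Real.sqrt (-τ) :=
      add_pos_of_nonneg_of_pos (norm_nonneg _) (Real.sqrt_pos.2 (neg_pos.2 hτ))
    rw [e, norm_smul, Real.norm_eq_abs, abs_of_pos (hlam k)]
    calc lam k * ‖u (t0 k + lam k ^ 2 * τ) (xs + lam k • y)‖
        ≤ lam k * (C' / (lam k * (‖y‖ + Real.sqrt (B k - τ)))) :=
          mul_le_mul_of_nonneg_left hb (hlam k).le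
      _ = C' / (‖y‖ + Real.sqrt (B k - τ)) := by
          rw [← mul_div_assoc, mul_div_mul_left _ _ (hlam k).ne']
      _ ≤ C' / (‖y‖ + Real.sqrt (-τ)) := by
          apply div_le_div_of_nonneg_left hC'0 hden2
          have : Real.sqrt (-τ) ≤ Real.sqrt (B k - τ) := Real.sqrt_le_sqrt (by linarith [hBpos k])
          linarith
  -- ### Step 8: the limit
  exact hubbleDynamo_zoom_limit hC hσ₀ A B w q ys hAlim hBpos hwcl hwmild hwI hwB hnorm1 hys hwD

end Summit.NavierStokesRegularity.NavierStokesRegularity.Theorems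

end
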